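import Summits.QuantumFields.YangMills.Theorems.BalabanUVNodesN08HaarCompatibilityGuardCoreInjective
import Summits.QuantumFields.YangMills.Theorems.BalabanUVNodesN08HaarCompatibilityGuardJacobianContractionOperator
import Mathlib.Analysis.Calculus.MeanValue

/-!
# BalabanUVNodes ∕ N08 — THE TANGENT DICTIONARY between pub-balaban's quaternion fibre map `kf` and its matrix form `Kmat`: `quatMatrix ∘ k′(u) = emlD ∘ quatMatrix`,
# `hs(quatMatrix q, quatMatrix q) = 2‖q‖²`; hence n08-w6's hs-CONTRACTION p620432 reads `‖k′(w)(w x)‖ ≤ ‖x‖` in `ℍ`, and the fibre map is 1-LIPSCHITZ along guarded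
# geodesics: `‖k(u eˣ) − k(u)‖ ≤ ‖x‖`

WIDTH SEAT `pub-ymgap-dag-n08-w3` g5, `W-SEAT-START-LIST.md` §0 (iii); item-3 lineage part 29A = the located item (i) of `N08-HK-CORE-SU2.md` §3 (range extension: centre
the target chart at `k(w₀)` instead of `w₀`), 2026-08-28.  DAG node N08 = [Balaban1985UV3] Thm 1 p. 257 + Thm 2 p. 272; [Balaban1987RG1] (0.4) p. 253; key item K1⁷
`StabilityBAtRecordR13SepCoPH` (stmt-QuantumFields-20542, `aside`), `--supports … --as helper`.  COUNT-NEUTRAL.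

WHAT THIS FILE PROVES (theorems only, 0 def; [folklore] bookkeeping between pub-balaban's `T4EMLFibreAC` (`kf`, `kD`, `Yf`) and `T4EMLTangentInjective` (`Kmat`, `emlD`,
`hs`) BY IMPORT, and n08-w6's `…JacobianContractionOperator.emlD_tangent_contraction` p620432 BY NAME):
 §1 `quatMatrix_mul_star` · `quatMatrix_kf_eq_Kmat` (on the log guard `‖aᵢū − 1‖ < 1`: `quatMatrix (k u) = Kmat (quatMatrix∘a) c (quatMatrix u)`) · `isOpen_guard` ·
    ★★ `quatMatrix_kD_eq_emlD` (**`quatMatrix (k′(u) v) = emlD (quatMatrix∘a) c (quatMatrix u) (quatMatrix v)`** — the two Fréchet derivatives of `u ↦ Kmat(quatMatrix u)`,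
    through pub-balaban's `hasStrictFDerivAt_Kmat` and `hasStrictFDerivAt_kf`, agree by `HasFDerivAt.unique` on the open guard).
 §2 `hs_quatMatrix_self` (**`hs(quatMatrix q, quatMatrix q) = 2‖q‖²`**) · `quatMatrix_mem_unitaryGroup` · ★★ `norm_kD_mul_le` (**`‖k′(w)(w x)‖ ≤ ‖x‖`** at a unit `w` in
    the guard `‖aᵢw̄ − 1‖ < 1∕2`, `cᵢ ≥ 0`, `Σcᵢ ≤ 1`, `x` imaginary — the hs-contraction in quaternion dress).
 §3 ★★ `norm_kf_sub_kf_le` (**`‖k(u eˣ) − k(u)‖ ≤ ‖x‖`** along a geodesic that stays in the guard `‖aᵢ − u e^{tx}‖ < δ ≤ 1∕2` — mean-value inequality; with part 26A's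
    geodesic convexity the whole guard set qualifies) · `norm_kf_sub_kf_le_of_guard` (endpoint form on the chordal guard `δ ≤ 1∕2`).
HONEST FRAMING: dictionary ∕ toolkit only; consumed by part 29B (the chart conjugate centred at `k(w₀)`, range `Σcᵢ < (sin θ∕θ)²`); (H_K) for the record's block
sizes (`8 ≤ θ.L`) is NOT reached by this route (n08-w6 g5's `…GuardIntrinsicJacobian` lane, existential K); E6′ NOT decided; count-neutral; N08 NOT discharged;
counts unmoved (typed 28∕28 · discharged 5∕27); R4 closes the CONDITIONAL rung `BalabanLadder.UV` only; the Yang–Mills mass gap (Clay) is NOT proved; nothing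
continuum ∕ OS.  0 `sorry`, standard axioms.
-/

noncomputable section

open NormedSpace Set Metric Function Filter
open scoped RealInnerProductSpace Topology Quaternion Matrix

namespace Summit.QuantumFields.YangMills.BalabanUVNodes.N08HaarCompatibilityGuardTangentDictionary

open Literature.MathematicalPhysics.QuantumFieldTheory.Balaban1983to89
open Literature.MathematicalPhysics.QuantumFieldTheory.Balaban1983to89.T4QuatExpLog
open Literature.MathematicalPhysics.QuantumFieldTheory.Balaban1983to89.T4EMLFibreAC
open Literature.MathematicalPhysics.QuantumFieldTheory.Balaban1983to89.T4EMLTangentInjective (Kmat emlD hs hs_self hasStrictFDerivAt_Kmat)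
open Literature.MathematicalPhysics.QuantumLattice (quatMatrix quatMatrix_mul quatMatrix_smul quatMatrix_apply_00 quatMatrix_apply_01 quatMatrix_apply_10
  quatMatrix_apply_11 quatToSU2 coe_quatToSU2_of_norm_eq_one)
open Literature.Geometry.GaugeTheory (quatMatrix_star)
open Literature.MathematicalPhysics.QuantumFieldTheory.Balaban1983to89.T4HaarSU2LocalDiffeo (quatMatrixCLM quatMatrixCLM_apply topRowQuat_quatMatrix)
open Literature.MathematicalPhysics.QuantumFieldTheory.Balaban1983to89.T4HaarSU2Translate (quatMatrix_sum)
open Summit.QuantumFields.YangMills.BalabanUVNodes.N08HaarCompatibilityGuardGeodesics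
open Summit.QuantumFields.YangMills.BalabanUVNodes.N08HaarCompatibilityGuardJacobianContractionOperator (emlD_tangent_contraction)

/-! ## §1 The dictionary for the map and for its derivative -/

section Dictionary

open scoped Matrix.Norms.L2Operator

variable {ι : Type*} [Fintype ι]

/-- `quatMatrix (a ū) = quatMatrix a · (quatMatrix u)*`. [folklore] -/
theorem quatMatrix_mul_star (a u : ℍ) : quatMatrix (a * star u) = quatMatrix a * star (quatMatrix u) := by
  rw [quatMatrix_mul, quatMatrix_star, Matrix.star_eq_conjTranspose]

/-- **THE MAP DICTIONARY** on the log guard `‖aᵢū − 1‖ < 1`: `quatMatrix (k u) = Kmat (quatMatrix∘a) c (quatMatrix u)` (pub-balaban's `quatMatrix_exp`, `quatMatrix_qlog`).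
[folklore] -/
theorem quatMatrix_kf_eq_Kmat (a : ι → ℍ) (c : ι → ℝ) {u : ℍ} (hg : ∀ i, ‖a i * star u - 1‖ < 1) :
    quatMatrix (kf a c u) = Kmat (fun i => quatMatrix (a i)) c (quatMatrix u) := by
  rw [kf, Kmat, quatMatrix_mul, quatMatrix_exp]
  congr 2
  rw [Yf, quatMatrix_sum]
  refine Finset.sum_congr rfl fun i _ => ?_
  rw [quatMatrix_smul, quatMatrix_qlog (hg i), quatMatrix_mul_star]

/-- The log guard `{u | ∀ i, ‖aᵢū − 1‖ < r}` is open. [folklore] -/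
theorem isOpen_guard (a : ι → ℍ) (r : ℝ) : IsOpen {u : ℍ | ∀ i, ‖a i * star u - 1‖ < r} := by
  rw [show {u : ℍ | ∀ i, ‖a i * star u - 1‖ < r} = ⋂ i, {u : ℍ | ‖a i * star u - 1‖ < r} by ext u; simp]
  exact isOpen_iInter_of_finite fun i =>
    isOpen_lt ((continuous_const.mul continuous_star).sub continuous_const).norm continuous_const

/-- ★★ **THE TANGENT DICTIONARY**: on the log guard, `quatMatrix (k′(u) v) = emlD (quatMatrix∘a) c (quatMatrix u) (quatMatrix v)` — both sides are the Fréchet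
derivative of `u ↦ Kmat(quatMatrix u) = quatMatrix (k u)` (`hasStrictFDerivAt_Kmat`, `hasStrictFDerivAt_kf`, uniqueness of the derivative). [folklore] -/
theorem quatMatrix_kD_eq_emlD (a : ι → ℍ) (c : ι → ℝ) {u : ℍ} (hg : ∀ i, ‖a i * star u - 1‖ < 1) (v : ℍ) :
    quatMatrix (kD a c u v) = emlD (fun i => quatMatrix (a i)) c (quatMatrix u) (quatMatrix v) := by
  have hW : ∀ i, ‖quatMatrix (a i) * star (quatMatrix u) - 1‖ < 1 := fun i => by
    rw [← quatMatrix_mul_star, norm_quatMatrix_sub_one]; exact hg i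
  have h1 : HasFDerivAt (fun u : ℍ => Kmat (fun i => quatMatrix (a i)) c (quatMatrix u))
      ((emlD (fun i => quatMatrix (a i)) c (quatMatrix u)).comp quatMatrixCLM) u :=
    (hasStrictFDerivAt_Kmat (fun i => quatMatrix (a i)) c hW).hasFDerivAt.comp u quatMatrixCLM.hasFDerivAt
  have h2 : HasFDerivAt (fun u : ℍ => quatMatrix (kf a c u)) (quatMatrixCLM.comp (kD a c u)) u :=
    quatMatrixCLM.hasFDerivAt.comp u (hasStrictFDerivAt_kf c hg).hasFDerivAt
  have hev : (fun u : ℍ => quatMatrix (kf a c u)) =ᶠ[𝓝 u] fun u : ℍ => Kmat (fun i => quatMatrix (a i)) c (quatMatrix u) := by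
    filter_upwards [(isOpen_guard a 1).mem_nhds (by exact hg)] with u' hu' using quatMatrix_kf_eq_Kmat a c hu'
  have heq := (h2.congr_of_eventuallyEq hev.symm).unique h1
  have := congrArg (fun f : ℍ →L[ℝ] Matrix (Fin 2) (Fin 2) ℂ => f v) heq
  simpa [ContinuousLinearMap.comp_apply] using this

end Dictionary

/-! ## §2 The Hilbert–Schmidt norm of a quaternion matrix; the contraction in `ℍ` -/

section Contraction

open scoped Matrix.Norms.L2Operator

variable {ι : Type*} [Fintype ι]

/-- **`hs(quatMatrix q, quatMatrix q) = 2‖q‖²`** (the four entries are `z, w, −w̄, z̄` with `|z|² + |w|² = ‖q‖²`). [folklore] -/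
theorem hs_quatMatrix_self (q : ℍ) : hs (quatMatrix q) (quatMatrix q) = 2 * ‖q‖ ^ 2 := by
  rw [hs_self, Fin.sum_univ_two, Fin.sum_univ_two, Fin.sum_univ_two, quatMatrix_apply_00, quatMatrix_apply_01, quatMatrix_apply_10, quatMatrix_apply_11,
    Complex.sq_norm, Complex.sq_norm, Complex.sq_norm, Complex.sq_norm, Complex.normSq_mk, Complex.normSq_mk, Complex.normSq_mk, Complex.normSq_mk,
    sq, ← Quaternion.normSq_eq_norm_mul_self, Quaternion.normSq_def']
  ring

/-- The matrix of a unit quaternion is unitary. [folklore] -/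
theorem quatMatrix_mem_unitaryGroup {u : ℍ} (hu : ‖u‖ = 1) : quatMatrix u ∈ Matrix.unitaryGroup (Fin 2) ℂ := by
  rw [← coe_quatToSU2_of_norm_eq_one hu]
  exact (Matrix.mem_specialUnitaryGroup_iff.mp (quatToSU2 u).2).1

/-- ★★ **THE hs-CONTRACTION IN QUATERNION DRESS**: at a unit `w` in the guard `‖aᵢw̄ − 1‖ < 1∕2` (unit `aᵢ`, `cᵢ ≥ 0`, `Σcᵢ ≤ 1`), for imaginary `x`:
**`‖k′(w)(w x)‖ ≤ ‖x‖`** — n08-w6's `emlD_tangent_contraction` p620432 through §1 and `hs_quatMatrix_self`. [folklore] -/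
theorem norm_kD_mul_le {a : ι → ℍ} (c : ι → ℝ) {w x : ℍ} (hw : ‖w‖ = 1) (ha : ∀ i, ‖a i‖ = 1) (hc : ∀ i, 0 ≤ c i) (hs1 : ∑ i, c i ≤ 1)
    (hg : ∀ i, ‖a i * star w - 1‖ < 1 / 2) (hx : x.re = 0) : ‖kD a c w (w * x)‖ ≤ ‖x‖ := by
  have hX : (quatMatrix x)ᴴ = -quatMatrix x := by
    rw [← quatMatrix_star, Quaternion.star_eq_neg.2 hx, Literature.MathematicalPhysics.QuantumLattice.quatMatrix_neg]
  have hg' : ∀ i, ‖quatMatrix (a i) * star (quatMatrix w) - 1‖ < 1 / 2 := fun i => by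
    rw [← quatMatrix_mul_star, norm_quatMatrix_sub_one]; exact hg i
  have h := emlD_tangent_contraction (fun i => quatMatrix_mem_unitaryGroup (ha i)) (quatMatrix_mem_unitaryGroup hw) hg' hc hs1 (quatMatrix x) hX
  rw [← quatMatrix_mul, ← quatMatrix_kD_eq_emlD a c (fun i => (hg i).trans (by norm_num)) (w * x), hs_quatMatrix_self, hs_quatMatrix_self] at h
  nlinarith [norm_nonneg (kD a c w (w * x)), norm_nonneg x]

end Contraction

/-! ## §3 The fibre map is 1-Lipschitz along guarded geodesics -/

section Lipschitz

variable {ι : Type*} [Fintype ι]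

/-- ★★ **`‖k(u eˣ) − k(u)‖ ≤ ‖x‖` ALONG A GUARDED GEODESIC**: for unit `aᵢ`, `cᵢ ≥ 0`, `Σcᵢ ≤ 1`, a unit `u`, an imaginary `x`, and `δ ≤ 1∕2` with `‖aᵢ − u e^{tx}‖ < δ` on
`t ∈ [0,1]`: the chain rule `(k∘γ)′(t) = k′(γ_t)(γ_t x)`, §2, and the mean-value inequality on `[0,1]`. [folklore] -/
theorem norm_kf_sub_kf_le {a : ι → ℍ} (c : ι → ℝ) (ha : ∀ i, ‖a i‖ = 1) (hc : ∀ i, 0 ≤ c i) (hs1 : ∑ i, c i ≤ 1) {δ : ℝ} (hδ : δ ≤ 1 / 2)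
    {u x : ℍ} (hu : ‖u‖ = 1) (hx : x.re = 0) (hg : ∀ t ∈ Icc (0 : ℝ) 1, ∀ i, ‖a i - u * exp (t • x)‖ < δ) :
    ‖kf a c (u * exp x) - kf a c u‖ ≤ ‖x‖ := by
  have hγ1 : ∀ t : ℝ, ‖u * exp (t • x)‖ = 1 := fun t => by
    rw [norm_mul, hu, norm_exp_of_re_eq_zero (by simp [hx]), mul_one]
  have hgd : ∀ t ∈ Icc (0 : ℝ) 1, ∀ i, ‖a i * star (u * exp (t • x)) - 1‖ < 1 / 2 := fun t ht i => by
    rw [norm_mul_star_sub_one (hγ1 t)]; exact (hg t ht i).trans_le hδ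
  have hder : ∀ t ∈ Icc (0 : ℝ) 1, HasDerivAt (fun s : ℝ => kf a c (u * exp (s • x))) (kD a c (u * exp (t • x)) (u * exp (t • x) * x)) t := by
    intro t ht
    have hγ : HasDerivAt (fun s : ℝ => u * exp (s • x)) (u * exp (t • x) * x) t := by
      have h := (hasDerivAt_exp_smul_const (𝕂 := ℝ) x t).const_mul u
      simpa [mul_assoc] using h
    exact (hasStrictFDerivAt_kf c fun i => (hgd t ht i).trans (by norm_num)).hasFDerivAt.comp_hasDerivAt t hγ
  have hbound : ∀ t ∈ Icc (0 : ℝ) 1, ‖kD a c (u * exp (t • x)) (u * exp (t • x) * x)‖ ≤ ‖x‖ := fun t ht =>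
    norm_kD_mul_le c (hγ1 t) ha hc hs1 (hgd t ht) hx
  have h := norm_image_sub_le_of_norm_deriv_le_segment_01' (f := fun s : ℝ => kf a c (u * exp (s • x)))
    (fun t ht => (hder t ht).hasDerivWithinAt) (fun t ht => hbound t (Ico_subset_Icc_self ht))
  simpa using h

/-- **Endpoint form on the chordal guard**: if `‖aᵢ − u‖ < δ` and `‖aᵢ − u eˣ‖ < δ` (`δ ≤ 1∕2`, `‖x‖ < π`), the geodesic stays guarded (part 26A) and
`‖k(u eˣ) − k(u)‖ ≤ ‖x‖`. [folklore] -/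
theorem norm_kf_sub_kf_le_of_guard {a : ι → ℍ} (c : ι → ℝ) (ha : ∀ i, ‖a i‖ = 1) (hc : ∀ i, 0 ≤ c i) (hs1 : ∑ i, c i ≤ 1) {δ : ℝ} (hδ : δ ≤ 1 / 2)
    {u x : ℍ} (hu : ‖u‖ = 1) (hx : x.re = 0) (hxπ : ‖x‖ < Real.pi) (h0 : ∀ i, ‖a i - u‖ < δ) (h1 : ∀ i, ‖a i - u * exp x‖ < δ) :
    ‖kf a c (u * exp x) - kf a c u‖ ≤ ‖x‖ :=
  norm_kf_sub_kf_le c ha hc hs1 hδ hu hx fun t ht i =>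
    norm_sub_mul_exp_smul_lt (ha i) hu hx hxπ (by linarith) (h0 i) (h1 i) ht.1 ht.2

end Lipschitz

end Summit.QuantumFields.YangMills.BalabanUVNodes.N08HaarCompatibilityGuardTangentDictionary

end
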